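import Summits.BirchSwinnertonDyer.BirchSwinnertonDyer.Theorems.QuadraticBranchSignedControlPlusEtaNonsurjPlusCoeffCongruenceQuotient
import HarnessLib

/-!
# Route `QuadraticBranchSignedControl` (rung K8, cell `bsd-potss`), residual crux `PlusEtaMainConjectureNonsurj`
# (stmt-BirchSwinnertonDyer-19606): THE QUOTIENT μ⁺-CERTIFICATE IN ROW CURRENCY — v7's `stub_analyticEtaMu_cm` AT ONE ROW `V` from
# Mazur's `p ∤ c₀` and ONE displayed pattern of `λ⁺ + 1` valuations of the exact quotient `θ_{2m}(η)/ω⁻_{2m}`, EVERY `λ⁺ ≤ p(p−1)`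
# (seat `bsd-potss-k8eta-c2` g26; sequel of `…PlusCoeffCongruenceQuotient.lean`, quotient twin of g25's `…PlusCoeffCongruenceMuCertificate.lean`)

WHY. v7's content stub `stub_analyticEtaMu_cm` reads, at a row `V` (globally minimal, good at `p ≥ 5`, `a_p(V) = 0`):
«`∀ f, IsNewformOf V f → ∀ ϖ, (period relation) → ∀ Lη, IsQuadraticBranchPlusLFunction f p ϖ Lη → HasUnitContent Lη`». g25's row-currency
certificate (`analyticEtaMu_row_of_mazurTate_padicNorm`) produces it from the low MOMENTS of `θ_{2m}(η)`, for `λ⁺ < p − 1` only; the prequel's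
quotient reading produces it from the coefficients of the exact QUOTIENT `ℓ_m = θ_{2m}(η)/ω⁻_{2m}` for EVERY `λ⁺ ≤ p(p−1)`. THIS FILE is the
row-currency form: `‖ϖ‖_p ≤ 1` is removed with Mazur's `hM` (g24's `norm_periodRatio_le_one_of_mazur`), `a_p(f) = 0` and `p ∤ N` come from
`IsNewformOf` — so a per-row μ⁺-record displays EXACTLY the row's kernel data, the named fact `hM`, and the valuations of `λ⁺ + 1` rationals
`ϖ·coeff_jℓ_m` (`j ≤ λ⁺ ≤ p(p−1)`, one level `2m ≥ 2`). The numerics that SUPPORT the displayed pattern per row: one exact division of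
`Σ_u TH₂[u](1+X)^u` by `Φ_p(1+X)` (k8eta-c2 g26 census P-26 over g25's level-2 symbol vectors).

WHAT. §16 `hasUnitContent_and_mu_lam_plus_of_mazurTate_quotient_padicNorm` (row currency; conclusion `HasUnitContent ∧ μ = 0 ∧ lam = λ ∧ normLam = λ`
for every `f, ϖ, Lη` of the row) and `analyticEtaMu_row_of_mazurTate_quotient_padicNorm` (conclusion VERBATIM the stub's inner statement).

HONEST FRAMING (cell `bsd-potss`; FULL-BSD rank ≤ 1 programme, HUMAN RULING D-0036/D-0074): TOOL THEOREMS ONLY — no definition, no named fact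
minted, no `sorry`, axioms standard; CONDITIONAL on the displayed named fact `hM` (Mazur); the quotient valuations stay DISPLAYED per-row
hypotheses; `stub_analyticEtaMu_cm` (a class-wide `∀ V`) is NOT proved; nothing about (A), (C1⁺_η), C-cc-1 or `BSD(W,p)` of any pair is claimed;
crux and route OPEN; nothing booked. `--supports stmt-BirchSwinnertonDyer-19606`.

References: [Pollack2003] Prop. 6.18; [Kobayashi2003] Thm. 3.2, (3.4), (3.6) (p. 7); [Mazur1978] Cor. 4.1; [GreenbergVatsal2000] p. 2 (1)–(2);
[Washington1997] §7.1.
-/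

set_option autoImplicit false
set_option linter.dupNamespace false
noncomputable section

open scoped Classical MatrixGroups ModularForm

open CongruenceSubgroup Polynomial WeierstrassCurve Literature.NumberTheory.EllipticCurves
  Literature.NumberTheory.EllipticCurves.ModularForms
  Literature.NumberTheory.EllipticCurves.GreenbergVatsal2000
  Literature.NumberTheory.EllipticCurves.Rank1Residual
open Summit.BirchSwinnertonDyer.Rank1Residual Summit.BirchSwinnertonDyer.Rank1Residual.Additive
open Summit.BirchSwinnertonDyer.BirchSwinnertonDyer.Theorems.EtaMinusCoeffCongruence

namespace Summit.BirchSwinnertonDyer.BirchSwinnertonDyer.Theorems.EtaPlusCoeffCongruence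

/-! ## §16 Row currency: the quotient μ⁺-certificate of a row `V` -/

section Rows

variable (p : ℕ) [hp : Fact p.Prime]

/-- **THE QUOTIENT μ⁺-CERTIFICATE OF A ROW (`λ⁺ = λ ≤ p(p−1)`, level `2m ≥ 2`).** `V` globally minimal, good at `p ≥ 5` with `a_p(V) = 0`; named fact
`hM` (Mazur: `‖ϖ‖_p ≤ 1` for every period ratio); DISPLAYED: for the newform `f` of `V` and every period ratio `ϖ`, with
`ℓ = quadraticBranchMazurTateElement p f (2m) /ₘ (cyclotomicOmegaMinus p (2m)).map (Int.castRingHom ℚ)` (the exact quotient `θ_{2m}(η)/ω⁻_{2m}`),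
`‖ϖ·coeff_jℓ‖_p ≤ p⁻¹` for `j < λ` and `‖ϖ·coeff_λℓ‖_p = 1`. CONCLUSION: every plus branch function `Lη` of `f` has `HasUnitContent Lη`, `μ(Lη) = 0`,
`λ(Lη) = λ`, `normLam Lη = λ`. [cite: Pollack2003, Prop. 6.18] [cite: Kobayashi2003, Thm. 3.2, (3.4), (3.6) (p. 7)] [cite: Mazur1978, Cor. 4.1] -/
theorem hasUnitContent_and_mu_lam_plus_of_mazurTate_quotient_padicNorm (hM : mazur_not_dvd_maninConstant_of_odd) (hp5 : 5 ≤ p)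
    (V : WeierstrassCurve ℚ) [V.IsElliptic] [V.IsGloballyMinimal] (hgood : V.HasGoodReductionAtPrime p)
    (hap : V.frobeniusTrace p = 0) (m : ℕ) (hm : 1 ≤ m) (lam : ℕ) (hlam : lam ≤ p * (p - 1))
    (hθ : ∀ {N : ℕ} [NeZero N] {f : CuspForm (Gamma0 N) 2}, IsNewformOf V f →
      ∀ (ϖ : ℚ), (if Even (p / 2) then (ϖ : ℝ) * V.realPeriodRat = plusPeriod f
          else (ϖ : ℝ) * V.imaginaryPeriodRat = minusPeriod f) →
        (∀ j < lam, ‖(ϖ : ℚ_[p]) * (((quadraticBranchMazurTateElement p f (2 * m) /ₘ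
            (cyclotomicOmegaMinus p (2 * m)).map (Int.castRingHom ℚ)).coeff j : ℚ) : ℚ_[p])‖ ≤ (p : ℝ)⁻¹) ∧
          ‖(ϖ : ℚ_[p]) * (((quadraticBranchMazurTateElement p f (2 * m) /ₘ
            (cyclotomicOmegaMinus p (2 * m)).map (Int.castRingHom ℚ)).coeff lam : ℚ) : ℚ_[p])‖ = 1) :
    ∀ {N : ℕ} [NeZero N] {f : CuspForm (Gamma0 N) 2}, IsNewformOf V f →
      ∀ (ϖ : ℚ), (if Even (p / 2) then (ϖ : ℝ) * V.realPeriodRat = plusPeriod f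
          else (ϖ : ℝ) * V.imaginaryPeriodRat = minusPeriod f) →
      ∀ (Lη : IwasawaAlgebra p), IsQuadraticBranchPlusLFunction f p ϖ Lη →
        HasUnitContent Lη ∧ X1.MuLambda.mu Lη = 0 ∧ X1.MuLambda.lam Lη = lam ∧ normLam Lη = lam := by
  intro N _ f hf ϖ hrel Lη hL
  have hp2 : p ≠ 2 := by omega
  have hϖ := norm_periodRatio_le_one_of_mazur p hM hp5 V f hf hgood hap ϖ hrel
  obtain ⟨hlow, htop⟩ := hθ hf ϖ hrel
  have hap' : cuspCoeff f p = ((0 : ℤ) : ℂ) := by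
    rw [cuspCoeff_eq_frobeniusTrace_of_isNewformOf_holds hf hgood, hap]
  exact hasUnitContent_and_mu_lam_plus_of_quotient_padicNorm hp2 hf.1 hf.coeffField_eq_bot (not_dvd_level_of_isNewformOf hf hgood)
    hap' hϖ hL m hm hlam hlow htop

/-- **v7's `stub_analyticEtaMu_cm` AT THE ROW `V`, from the quotient** (`λ⁺ = λ ≤ p(p−1)`, level `2m ≥ 2`): same data, conclusion VERBATIM the stub's
inner statement `∀ f ϖ Lη, IsNewformOf V f → (period relation) → IsQuadraticBranchPlusLFunction f p ϖ Lη → HasUnitContent Lη`.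
[cite: Pollack2003, Prop. 6.18] [cite: Kobayashi2003, Thm. 3.2, (3.4), (3.6) (p. 7)] [cite: Mazur1978, Cor. 4.1] [cite: GreenbergVatsal2000, p. 2, (2)] -/
theorem analyticEtaMu_row_of_mazurTate_quotient_padicNorm (hM : mazur_not_dvd_maninConstant_of_odd) (hp5 : 5 ≤ p)
    (V : WeierstrassCurve ℚ) [V.IsElliptic] [V.IsGloballyMinimal] (hgood : V.HasGoodReductionAtPrime p)
    (hap : V.frobeniusTrace p = 0) (m : ℕ) (hm : 1 ≤ m) (lam : ℕ) (hlam : lam ≤ p * (p - 1))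
    (hθ : ∀ {N : ℕ} [NeZero N] {f : CuspForm (Gamma0 N) 2}, IsNewformOf V f →
      ∀ (ϖ : ℚ), (if Even (p / 2) then (ϖ : ℝ) * V.realPeriodRat = plusPeriod f
          else (ϖ : ℝ) * V.imaginaryPeriodRat = minusPeriod f) →
        (∀ j < lam, ‖(ϖ : ℚ_[p]) * (((quadraticBranchMazurTateElement p f (2 * m) /ₘ
            (cyclotomicOmegaMinus p (2 * m)).map (Int.castRingHom ℚ)).coeff j : ℚ) : ℚ_[p])‖ ≤ (p : ℝ)⁻¹) ∧
          ‖(ϖ : ℚ_[p]) * (((quadraticBranchMazurTateElement p f (2 * m) /ₘ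
            (cyclotomicOmegaMinus p (2 * m)).map (Int.castRingHom ℚ)).coeff lam : ℚ) : ℚ_[p])‖ = 1) :
    ∀ {N : ℕ} [NeZero N] {f : CuspForm (Gamma0 N) 2}, IsNewformOf V f →
      ∀ (ϖ : ℚ), (if Even (p / 2) then (ϖ : ℝ) * V.realPeriodRat = plusPeriod f
          else (ϖ : ℝ) * V.imaginaryPeriodRat = minusPeriod f) →
      ∀ (Lη : IwasawaAlgebra p), IsQuadraticBranchPlusLFunction f p ϖ Lη → HasUnitContent Lη :=
  fun hf ϖ hrel Lη hL ↦
    (hasUnitContent_and_mu_lam_plus_of_mazurTate_quotient_padicNorm p hM hp5 V hgood hap m hm lam hlam hθ hf ϖ hrel Lη hL).1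

end Rows

end Summit.BirchSwinnertonDyer.BirchSwinnertonDyer.Theorems.EtaPlusCoeffCongruence

end
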